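import Mathlib.Tactic.IntervalCases
import Summits.CriticalPhenomena.PercolationContinuityZ3.Theorems.PercNearOneGluingNoHeavyLowerTailSahiCTCLadderThreeRowOneDense
import HarnessLib

/-!
# `NoHeavyLowerTail` (crux stmt-CriticalPhenomena-4575), P3 lane: the row `#dbl = 2` of `(L_3)` in the dense-triple regime — PART 1/3: cubes, charge bound, arithmetic

Support file (seat `prim-l12-p3`, gen 26, split into three files ≤ 400 lines and landed gen 42; `--supports stmt-CriticalPhenomena-4575`).  Memo g26 §4.12.  For a profile `m = 2·1_D + 1_T`
with `#D = 2` the cubes of `[m](e_3·H)` are the 3-live RESTRICTIONS `κ(∅, D ∪ T∖y)` (`y ∈ T`), the 2-live LINKS `κ({d_i}, d_j ∪ T∖Q)`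
(`Q ⊆ T` a pair) and the 1-live double links `κ(D, T∖E)` (`E ⊆ T` a triple); the charge is `cH(3,τ+1)·a + cH(2,τ−1)·(q₁+q₂) +
cH(1,τ−3)·ε` with `a = #{y : D + y ∈ 𝒳∩𝒵}`, `q_j = #{Q : d_j + Q ∈ 𝒳∩𝒵}`, `ε = #{E ⊆ T : E ∈ 𝒳∩𝒵}`.  Peeling the restriction cubes at
`d₁` and `d₂` (`kap_rec`) and bounding every resulting cube by t-DENSITY proves the row whenever `6ε ≥ a(τ−1)(τ−2)` (triples at least as
dense as the set `𝒜`): **`coeff_ladder_three_rowTwo_nonneg_of_dense`** (`τ ≥ 7`; exact at `H_3`).  Nothing is asserted about the crux.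
-/

namespace Summit.CriticalPhenomena.PercolationContinuityZ3.Theorems.SahiCTCForms

open Finset MvPolynomial SahiCTCGenFun SahiCTCWeightedLYM

variable {α : Type*} [DecidableEq α] [Fintype α]

section RowTwo
variable {𝒳 𝒵 : Finset (Finset α)}

/-- The restriction cube at `Y = {y} ⊆ T`: `[m − 1_{D ∪ Y}] H = κ(∅, D ∪ (T∖Y))`. [this work] -/
theorem coeff_harris_cube_rowTwo_R {m : α →₀ ℕ} (hm : ∀ i, m i ≤ 2) {Y : Finset α} (hY : Y ⊆ lev m 1) :
    (PiP * gf (𝒳 ∩ 𝒵) - gf 𝒳 * gf 𝒵).coeff (m - ind (dbl m ∪ Y)) = kap 𝒳 𝒵 ∅ (dbl m ∪ (lev m 1 \ Y)) := by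
  rw [coeff_harrisForm_eq_kap _ _ (sub_ind_le_two_of_le_two hm _), dbl_sub_ind_of_le_two hm, sgl_sub_ind_of_le_two hm]
  have hYD : Disjoint (dbl m) Y := (disjoint_dbl_lev_one m).mono_right hY
  congr 1
  · exact sdiff_eq_empty_iff_subset.2 subset_union_left
  · rw [inter_eq_left.2 subset_union_left]
    congr 1
    ext i; simp only [mem_sdiff, mem_union, not_or]
    constructor
    · rintro ⟨hi, _, hiY⟩; exact ⟨hi, hiY⟩
    · rintro ⟨hi, hiY⟩; exact ⟨hi, fun h => disjoint_left.1 (disjoint_dbl_lev_one m) h hi, hiY⟩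

/-- The double-link cube at a triple `E ⊆ T`: `[m − 1_E] H = κ(D, T∖E)`. [this work] -/
theorem coeff_harris_cube_rowTwo_L {m : α →₀ ℕ} (hm : ∀ i, m i ≤ 2) {E : Finset α} (hE : E ⊆ lev m 1) :
    (PiP * gf (𝒳 ∩ 𝒵) - gf 𝒳 * gf 𝒵).coeff (m - ind E) = kap 𝒳 𝒵 (dbl m) (lev m 1 \ E) := by
  rw [coeff_harrisForm_eq_kap _ _ (sub_ind_le_two_of_le_two hm _), dbl_sub_ind_of_le_two hm, sgl_sub_ind_of_le_two hm]
  have hED : Disjoint (dbl m) E := (disjoint_dbl_lev_one m).mono_right hE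
  rw [sdiff_eq_self_of_disjoint hED, disjoint_iff_inter_eq_empty.1 hED, empty_union]

/-- **Cubes of the row `#dbl = 2`**: restriction, link and double-link cubes are dominated by `[m](e_3·H)`. [this work] -/
theorem cubes_le_coeff_ee_mul_harris_rowTwo (h𝒳 : IsUpperSet (𝒳 : Set (Finset α))) (h𝒵 : IsUpperSet (𝒵 : Set (Finset α)))
    {m : α →₀ ℕ} (hm : ∀ i, m i ≤ 2) (hD : #(dbl m) = 2) :
    ∑ Y ∈ (lev m 1).powersetCard 1, kap 𝒳 𝒵 ∅ (dbl m ∪ (lev m 1 \ Y)) +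
      ∑ d ∈ dbl m, ∑ Q ∈ (lev m 1).powersetCard 2, kapL1 𝒳 𝒵 m d Q +
      ∑ E ∈ (lev m 1).powersetCard 3, kap 𝒳 𝒵 (dbl m) (lev m 1 \ E) ≤
      (ee 3 * (PiP * gf (𝒳 ∩ 𝒵) - gf 𝒳 * gf 𝒵)).coeff m := by
  unfold kapL1
  have hDT : Disjoint (dbl m) (lev m 1) := disjoint_dbl_lev_one m
  set S₀ := ((lev m 1).powersetCard 1).image fun Y => dbl m ∪ Y
  set S₁ := (dbl m ×ˢ (lev m 1).powersetCard 2).image fun q => insert q.1 q.2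
  set S₂ := (lev m 1).powersetCard 3
  have hcardD : ∀ E, (E ∈ S₀ → #(dbl m ∩ E) = 2) ∧ (E ∈ S₁ → #(dbl m ∩ E) = 1) ∧ (E ∈ S₂ → #(dbl m ∩ E) = 0) := fun E => by
    refine ⟨fun h => ?_, fun h => ?_, fun h => ?_⟩
    · obtain ⟨Y, hY, rfl⟩ := mem_image.1 h
      rw [inter_union_distrib_left, inter_self, disjoint_iff_inter_eq_empty.1 (hDT.mono_right (mem_powersetCard.1 hY).1),
        union_empty, hD]
    · obtain ⟨q, hq, rfl⟩ := mem_image.1 h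
      obtain ⟨hq1, hq2⟩ := mem_product.1 hq
      rw [inter_insert_of_mem hq1, disjoint_iff_inter_eq_empty.1 (hDT.mono_right (mem_powersetCard.1 hq2).1), insert_empty_eq,
        card_singleton]
    · rw [disjoint_iff_inter_eq_empty.1 (hDT.mono_right (mem_powersetCard.1 h).1), card_empty]
  have hadm : S₀ ∪ S₁ ∪ S₂ ⊆ (bySize (· = 3) : Finset (Finset α)).filter fun E => ind E ≤ m := by
    intro E hE
    rw [mem_filter, bySize, mem_filter, SahiAllButC.ind_le_iff_subset_support, support_eq_dbl_union_lev hm]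
    refine ⟨⟨mem_powerset.2 (subset_univ _), ?_⟩, ?_⟩
    · rcases mem_union.1 hE with hE | hE
      · rcases mem_union.1 hE with hE | hE
        · obtain ⟨Y, hY, rfl⟩ := mem_image.1 hE
          rw [card_union_of_disjoint (hDT.mono_right (mem_powersetCard.1 hY).1), hD, (mem_powersetCard.1 hY).2]
        · obtain ⟨q, hq, rfl⟩ := mem_image.1 hE
          obtain ⟨hq1, hq2⟩ := mem_product.1 hq
          rw [card_insert_of_notMem (fun h => disjoint_left.1 hDT hq1 ((mem_powersetCard.1 hq2).1 h)), (mem_powersetCard.1 hq2).2]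
      · exact (mem_powersetCard.1 hE).2
    · rcases mem_union.1 hE with hE | hE
      · rcases mem_union.1 hE with hE | hE
        · obtain ⟨Y, hY, rfl⟩ := mem_image.1 hE
          exact union_subset_union Subset.rfl (mem_powersetCard.1 hY).1
        · obtain ⟨q, hq, rfl⟩ := mem_image.1 hE
          obtain ⟨hq1, hq2⟩ := mem_product.1 hq
          exact insert_subset (mem_union_left _ hq1) ((mem_powersetCard.1 hq2).1.trans subset_union_right)
      · exact (mem_powersetCard.1 hE).1.trans subset_union_right
  have hd01 : Disjoint S₀ S₁ := disjoint_left.2 fun E h0 h1 => by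
    have := (hcardD E).1 h0; have := (hcardD E).2.1 h1; omega
  have hd2 : Disjoint (S₀ ∪ S₁) S₂ := disjoint_left.2 fun E h h2 => by
    have h2' := (hcardD E).2.2 h2
    rcases mem_union.1 h with h | h
    · have := (hcardD E).1 h; omega
    · have := (hcardD E).2.1 h; omega
  have hinj₀ : Set.InjOn (fun Y : Finset α => dbl m ∪ Y) ↑((lev m 1).powersetCard 1) := fun Y hY Y' hY' h => by
    have hY := (mem_powersetCard.1 (Finset.mem_coe.1 hY)).1
    have hY' := (mem_powersetCard.1 (Finset.mem_coe.1 hY')).1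
    have e : (dbl m ∪ Y) \ dbl m = (dbl m ∪ Y') \ dbl m := by rw [show dbl m ∪ Y = dbl m ∪ Y' from h]
    rwa [union_sdiff_left, union_sdiff_left, sdiff_eq_self_of_disjoint (hDT.symm.mono_left hY),
      sdiff_eq_self_of_disjoint (hDT.symm.mono_left hY')] at e
  have hinj₁ : Set.InjOn (fun q : α × Finset α => insert q.1 q.2) ↑(dbl m ×ˢ (lev m 1).powersetCard 2) := by
    intro q hq q' hq' h
    obtain ⟨hq1, hq2⟩ := mem_product.1 (Finset.mem_coe.1 hq)
    obtain ⟨hq1', hq2'⟩ := mem_product.1 (Finset.mem_coe.1 hq')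
    have hQ := (mem_powersetCard.1 hq2).1
    have hQ' := (mem_powersetCard.1 hq2').1
    have h' : insert q.1 q.2 = insert q'.1 q'.2 := h
    have hx : q.1 = q'.1 := by
      have e : dbl m ∩ insert q.1 q.2 = dbl m ∩ insert q'.1 q'.2 := by rw [h']
      rw [inter_insert_of_mem hq1, inter_insert_of_mem hq1', disjoint_iff_inter_eq_empty.1 (hDT.mono_right hQ),
        disjoint_iff_inter_eq_empty.1 (hDT.mono_right hQ'), insert_empty_eq, insert_empty_eq] at e
      exact singleton_injective e
    have hQQ : q.2 = q'.2 := by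
      have e : (insert q.1 q.2).erase q.1 = (insert q'.1 q'.2).erase q.1 := by rw [h']
      rwa [erase_insert (fun h => disjoint_left.1 hDT hq1 (hQ h)), hx,
        erase_insert (fun h => disjoint_left.1 hDT hq1' (hQ' h))] at e
    exact Prod.ext hx hQQ
  have hsur := sum_le_coeff_ee_mul_harris h𝒳 h𝒵 3 m hadm
  rw [sum_union hd2, sum_union hd01, sum_image hinj₀, sum_image hinj₁,
    sum_congr rfl fun Y hY => coeff_harris_cube_rowTwo_R hm (mem_powersetCard.1 hY).1,
    sum_congr rfl fun q hq => coeff_harris_cube_L1 hm (mem_product.1 hq).1 (mem_powersetCard.1 (mem_product.1 hq).2).1,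
    sum_congr rfl fun E hE => coeff_harris_cube_rowTwo_L hm (mem_powersetCard.1 hE).1, sum_product] at hsur
  exact hsur

/-- **Charge of the row `#dbl = 2`** (`τ ≥ 4`): `[m](Θ_2·e_{≥3}·GF(W)) ≤ cH(3,τ+1)·#{Y : D ∪ Y ∈ W} + cH(2,τ−1)·Σ_d #{Q : d + Q ∈ W}
+ cH(1,τ−3)·#{E ⊆ T : E ∈ W}`. [this work] -/
theorem coeff_chargeT_rowTwo_le {m : α →₀ ℕ} (hm : ∀ i, m i ≤ 2) (hD : #(dbl m) = 2) (hτ : 4 ≤ #(lev m 1))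
    (W : Finset (Finset α)) (hW : ∀ w ∈ W, #w = 3) :
    (gf (bySize (· ≤ 3 - 1) : Finset (Finset α)) * gf (bySize (3 ≤ ·) : Finset (Finset α)) * gf W).coeff m ≤
      (cH 3 (#(lev m 1) + 1) : ℤ) * #(((lev m 1).powersetCard 1).filter fun Y => dbl m ∪ Y ∈ W) +
        (cH 2 (#(lev m 1) - 1) : ℤ) * ∑ d ∈ dbl m, #(((lev m 1).powersetCard 2).filter fun Q => insert d Q ∈ W) +
        (cH 1 (#(lev m 1) - 3) : ℤ) * #(((lev m 1).powersetCard 3).filter fun E => E ∈ W) := by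
  rw [coeff_chargeT_eq_sum]
  set Wm := W.filter fun w => ind w ≤ m
  have hDT : Disjoint (dbl m) (lev m 1) := disjoint_dbl_lev_one m
  have hval : ∀ w ∈ Wm, (gf (bySize (· ≤ 3 - 1) : Finset (Finset α)) * gf (bySize (3 ≤ ·) : Finset (Finset α))).coeff (m - ind w) =
      (if #(dbl m ∩ w) = 2 then (cH 3 (#(lev m 1) + 1) : ℤ) else 0) + (if #(dbl m ∩ w) = 1 then (cH 2 (#(lev m 1) - 1) : ℤ) else 0) +
        (if #(dbl m ∩ w) = 0 then (cH 1 (#(lev m 1) - 3) : ℤ) else 0) := fun w hw => by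
    obtain ⟨hwW, hwm⟩ := mem_filter.1 hw
    have hwt := hW w hwW
    rw [coeff_thetaT_mul_atLeastT_eq_cH (by norm_num) (sub_ind_le_two_of_le_two hm w), dbl_sub_ind_of_le_two hm, sgl_sub_ind_of_le_two hm]
    have hsd : #(dbl m \ w) + #(dbl m ∩ w) = 2 := by rw [card_sdiff_add_card_inter, hD]
    have hcu : #(dbl m ∩ w ∪ lev m 1 \ w) = #(dbl m ∩ w) + #(lev m 1 \ w) :=
      card_union_of_disjoint (Disjoint.mono inter_subset_left sdiff_subset hDT)
    have hTw : #(lev m 1 \ w) + #(lev m 1 ∩ w) = #(lev m 1) := card_sdiff_add_card_inter _ _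
    have hwsupp : w ⊆ dbl m ∪ lev m 1 := by
      rw [← support_eq_dbl_union_lev hm]; exact (SahiAllButC.ind_le_iff_subset_support _ _).1 hwm
    have hsplit : #(dbl m ∩ w) + #(lev m 1 ∩ w) = 3 := by
      rw [← card_union_of_disjoint (Disjoint.mono inter_subset_left inter_subset_left hDT), ← union_inter_distrib_right,
        inter_eq_right.2 hwsupp, hwt]
    have hle : #(dbl m ∩ w) ≤ 2 := by have := card_le_card (inter_subset_left (s₁ := dbl m) (s₂ := w)); omega
    interval_cases h : #(dbl m ∩ w)
    · simp only [if_neg (by norm_num : ¬(0:ℕ) = 2), if_neg (by norm_num : ¬(0:ℕ) = 1), if_true, zero_add]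
      rw [show 3 - #(dbl m \ w) = 1 from by omega, hcu]; congr 2; omega
    · simp only [if_neg (by norm_num : ¬(1:ℕ) = 2), if_true, if_neg (by norm_num : ¬(1:ℕ) = 0), zero_add, add_zero]
      rw [show 3 - #(dbl m \ w) = 2 from by omega, hcu]; congr 2; omega
    · simp only [if_true, if_neg (by norm_num : ¬(2:ℕ) = 1), if_neg (by norm_num : ¬(2:ℕ) = 0), add_zero]
      rw [show 3 - #(dbl m \ w) = 3 from by omega, hcu]; congr 2; omega
  rw [sum_congr rfl hval, sum_add_distrib, sum_add_distrib]
  have e2 : ∑ w ∈ Wm, (if #(dbl m ∩ w) = 2 then (cH 3 (#(lev m 1) + 1) : ℤ) else 0) =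
      (cH 3 (#(lev m 1) + 1) : ℤ) * #(Wm.filter fun w => #(dbl m ∩ w) = 2) := by
    rw [← sum_filter, sum_const, nsmul_eq_mul, mul_comm]
  have e1 : ∑ w ∈ Wm, (if #(dbl m ∩ w) = 1 then (cH 2 (#(lev m 1) - 1) : ℤ) else 0) =
      (cH 2 (#(lev m 1) - 1) : ℤ) * #(Wm.filter fun w => #(dbl m ∩ w) = 1) := by
    rw [← sum_filter, sum_const, nsmul_eq_mul, mul_comm]
  have e0 : ∑ w ∈ Wm, (if #(dbl m ∩ w) = 0 then (cH 1 (#(lev m 1) - 3) : ℤ) else 0) =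
      (cH 1 (#(lev m 1) - 3) : ℤ) * #(Wm.filter fun w => #(dbl m ∩ w) = 0) := by
    rw [← sum_filter, sum_const, nsmul_eq_mul, mul_comm]
  rw [e2, e1, e0]
  -- the three counts
  have c2 : #(Wm.filter fun w => #(dbl m ∩ w) = 2) ≤ #(((lev m 1).powersetCard 1).filter fun Y => dbl m ∪ Y ∈ W) := by
    refine (card_WC_le_sum hm W hW).trans (le_of_eq ?_)
    rw [show (dbl m).powersetCard 2 = {dbl m} from by
      rw [← hD, powersetCard_self], sum_singleton]
    refine card_bij (fun y _ => {y}) (fun y hy => ?_) (fun y _ y' _ h => singleton_injective h) (fun Y hY => ?_)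
    · obtain ⟨hyT, hyW⟩ := mem_filter.1 hy
      exact mem_filter.2 ⟨mem_powersetCard.2 ⟨singleton_subset_iff.2 hyT, card_singleton y⟩, by rwa [union_comm, ← insert_eq]⟩
    · obtain ⟨hY1, hYW⟩ := mem_filter.1 hY
      obtain ⟨hYT, hYc⟩ := mem_powersetCard.1 hY1
      obtain ⟨y, rfl⟩ := card_eq_one.1 hYc
      exact ⟨y, mem_filter.2 ⟨hYT (mem_singleton_self y), by rwa [insert_eq, union_comm]⟩, rfl⟩
  have c1 := card_WC1_le_sum hm W hW
  have c0 : #(Wm.filter fun w => #(dbl m ∩ w) = 0) ≤ #(((lev m 1).powersetCard 3).filter fun E => E ∈ W) := by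
    refine card_le_card fun w hw => ?_
    obtain ⟨hw, h0⟩ := mem_filter.1 hw
    obtain ⟨hwW, hwm⟩ := mem_filter.1 hw
    have hwsupp : w ⊆ dbl m ∪ lev m 1 := by
      rw [← support_eq_dbl_union_lev hm]; exact (SahiAllButC.ind_le_iff_subset_support _ _).1 hwm
    refine mem_filter.2 ⟨mem_powersetCard.2 ⟨fun i hi => ?_, hW w hwW⟩, hwW⟩
    rcases mem_union.1 (hwsupp hi) with h | h
    · have : i ∈ dbl m ∩ w := mem_inter.2 ⟨h, hi⟩
      rw [card_eq_zero.1 h0] at this; exact absurd this (notMem_empty i)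
    · exact h
  have p3 : (0 : ℤ) ≤ cH 3 (#(lev m 1) + 1) := Nat.cast_nonneg _
  have p2 : (0 : ℤ) ≤ cH 2 (#(lev m 1) - 1) := Nat.cast_nonneg _
  have p1 : (0 : ℤ) ≤ cH 1 (#(lev m 1) - 3) := Nat.cast_nonneg _
  have c2' : (#(Wm.filter fun w => #(dbl m ∩ w) = 2) : ℤ) ≤ #(((lev m 1).powersetCard 1).filter fun Y => dbl m ∪ Y ∈ W) := by
    exact_mod_cast c2
  have c1' : (#(Wm.filter fun w => #(dbl m ∩ w) = 1) : ℤ) ≤ ∑ d ∈ dbl m, (#(((lev m 1).powersetCard 2).filter fun Q => insert d Q ∈ W) : ℤ) := by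
    exact_mod_cast c1
  have c0' : (#(Wm.filter fun w => #(dbl m ∩ w) = 0) : ℤ) ≤ #(((lev m 1).powersetCard 3).filter fun E => E ∈ W) := by
    exact_mod_cast c0
  push_cast
  nlinarith [mul_le_mul_of_nonneg_left c2' p3, mul_le_mul_of_nonneg_left c1' p2, mul_le_mul_of_nonneg_left c0' p1]

set_option maxHeartbeats 400000 in
/-- The integer arithmetic of the dense regime of the row `#dbl = 2` (`n = τ − 1`). [this work] -/
theorem rowTwo_dense_arith {n B₁ B₂ B₃ M₁ M₂ L a q ε a' q' ε' Γ cH3 : ℤ} (hn : 6 ≤ n)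
    (f1 : a ≤ B₁) (f2 : 2 * (n + 1) * q ≤ n * B₂) (f3 : 6 * cH3 * ε ≤ n * (n - 1) * B₃) (f4 : n * q ≤ M₂) (f5 : a * n ≤ M₁)
    (f6 : a * n * (n - 1) ≤ 6 * L) (ecH3 : 2 * cH3 = n ^ 2 + n + 2) (eΓ : 2 * Γ = (n + 2) ^ 2 + (n + 2) + 2)
    (ha : a' ≤ a) (hq : q' ≤ q) (hε : ε' ≤ ε) (hε0 : 0 ≤ ε')
    (hd1 : a * n * (n - 1) ≤ 6 * ε) (hd2 : a * n ≤ q) :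
    Γ * a' + (n + 1) * q' + ε' ≤ B₃ + B₂ + B₁ + M₂ + M₁ + L := by
  have hP : (0 : ℤ) < 6 * n * (n - 1) := by nlinarith
  have hΓ0 : 0 ≤ Γ := by nlinarith [eΓ]
  have hmono : Γ * a' + (n + 1) * q' + ε' ≤ Γ * a + (n + 1) * q + ε := by nlinarith [mul_le_mul_of_nonneg_left ha hΓ0]
  refine hmono.trans (le_of_mul_le_mul_left ?_ hP)
  have p1 := mul_le_mul_of_nonneg_left f1 hP.le
  have p2 := mul_le_mul_of_nonneg_left f2 (by nlinarith : (0 : ℤ) ≤ 6 * (n - 1))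
  have p3 := mul_le_mul_of_nonneg_left f3 (by norm_num : (0 : ℤ) ≤ 6)
  have p4 := mul_le_mul_of_nonneg_left f4 (by nlinarith : (0 : ℤ) ≤ 6 * (n - 1))
  have p5 := mul_le_mul_of_nonneg_left f5 (by nlinarith : (0 : ℤ) ≤ 6 * (n - 1))
  have p6 := mul_le_mul_of_nonneg_left f6 (by nlinarith : (0 : ℤ) ≤ n * (n - 1))
  have c1 := mul_le_mul_of_nonneg_left hd1 (by nlinarith : (0 : ℤ) ≤ 2 * (n ^ 2 + 2 * n + 3))
  have c2 := mul_le_mul_of_nonneg_left hd2 (by nlinarith : (0 : ℤ) ≤ 6 * (n - 1) * (n + 2))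
  nlinarith [p1, p2, p3, p4, p5, p6, c1, c2, ecH3, eΓ]

end RowTwo

end Summit.CriticalPhenomena.PercolationContinuityZ3.Theorems.SahiCTCForms
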